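import Summits.QuantumFields.BalabanUV.T4Continuum.Support.NE7TangentTransportGaugedTop
import Summits.QuantumFields.BalabanUV.T4Continuum.Support.NE7TangentTransportSameTopDocked
import Summits.QuantumFields.BalabanUV.T4Continuum.Support.NE7QbarCurvedBaseTower
import HarnessLib

/-!
# NE7TangentTransportGaugedTopDocked — THE (L4) LETTER OF THE CURVED (APE) FOR AN ARBITRARY (UNPINNED) REPRESENTATIVE `U^u = We^{Z}` OF A FIELD OVER `W`'s DATUM,
# EVERY LETTER DISCHARGED: `hTT` with `τ = x′·c₁(x′)·(M^d∕M²)·(K_maj q^k (C₁L^k(e^{α₀} − 1) + C₂(L²)^k x′) + 2·θ·K_maj q^{k+1})`, `θ = ‖u − 1‖_∞` — F84 ∘ F73 ∘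
# `NE7MajorantL1`; letter (L4) of the curved (APE) programme, file 19 (docking)

Cell `pub-balaban`, rung (B)+1 sub-cell t4, lineage `b2b-balaban-t4-ne7-p1` (CRUX PROVER NE7 #1 = OWNER of row NE7), generation 77; memo
`t4/b2b-balaban-t4-ne7-p1-g77/GAUGED-TOP-TT.md`.  File F85 (over F84 `NE7TangentTransportGaugedTop.tangent_transport_gaugedTop_rightInvW`, F73
`NE7QbarCurvedBaseBudget.sum_norm_QbarIter_sub_QbarIter_le_budget` (Λ in closed form), F68 `NE7QbarCurvedBaseTower.sum_norm_QbarIter_le_prod` and `NE7MajorantL1.prod_step_le`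
(the single-background letter `Λ_W = K_maj·(L∕L^d)^{k+1}`), `NE3CpushGaugeCovariance.cavgIter_gaugeAct`, `NE3EnergyVary.smallField_vary`, `vary_isUnitaryCfg`, `vary_add_period`).
WHY.  F75 `NE7TangentTransportSameTopDocked` discharged F66's `hTT` only for FIBRE-PRESERVING representatives (`cavgIter (We^{Z}) = cavgIter W`), which is why gen 76 went after a
corner-pinned representative («REP WITH A FIXED TOP», F79–F83) — whose last letter (HR_W)ₚ fails level-uniformly (memo §1).  By F84 the pinning is unnecessary: for ANY
representative `U^u = We^{Z}` of a field `U` over `W`'s datum the top of `We^{Z}` is `(W_top)^{u∘M•}` (`cavgIter_gaugeAct`), and F84's conjugated lift transports the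
`W`-tangents at the price `Λ + 2θΛ_W`, `θ = ‖u − 1‖_∞`.  THIS FILE docks every letter by name: `Λ` by F73 at the relative radius `e^{α₀} − 1` and the common class radius
`x′ = x + 4(e^{α₀} − 1)` (as in F75), `Λ_W = K_maj·(L∕L^d)^{k+1}` by F68 §1 + `prod_step_le` at `x′`, `c = u∘M•` unitary `N`-periodic with `‖c − 1‖ ≤ θ`.  CURRENCY: the
new term `2θ·K_maj·(L∕L^d)^{k+1} = 2θ·K_maj·M^{1−d}` sits next to F73's `K_maj q^k(…) = M^{1−d}·O(L^{d−2}α̂ + L^{d−3}b)`; for row NE3's E′ `θ = 4c₀M²c_Rb₀` — so the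
(L4) letter closes under a level-uniform smallness of `M²b₀`, the (−2) quantity E′'s regime already constrains (`c₀M²c_Rb₀ ≤ 1∕10`).  F86 docks this into the (APE).
WHAT ([folklore]; 0 def, 0 sorry).  §1 `isPeriodic_corner_gauge` (the coarse gauge `u∘M•` is `N`-periodic), `sum_norm_QbarIter_le_Kmaj` (the single-background letter in
closed form).  §2 **`hTT_gaugedTop`** — F66's `hTT` SHAPE for `We^{Z} = U^u`, `cavgIter U = cavgIter W`, `‖Z‖ ≤ α₀`, `‖u − 1‖ ≤ θ`, with the explicit `τ` displayed above.
HONEST FRAMING (page 1): composition of tree files; (L1), `α₁`, (L2), (L3) untouched; nothing of Bałaban's asserted; (APE) on curved data NOT proved; NOT ONE-STEP, NOT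
NE7; spine 0∕9; finite T⁴ rung (B)+1 — NOT infinite volume, NOT mass gap, NOT `BetaPertH`, NOT Clay.  Continuum YM on T⁴ ⇐ BetaPertH ∧ nine spine estimates (0/9 proved);
BetaPertH ⇐ (D1) ∧ (D4) ∧ CAP+tail; G-an2-4 gates asym, D1 and NE2/3/4.
-/

set_option autoImplicit false

open scoped BigOperators Matrix.Norms.L2Operator
open NormedSpace Finset

namespace Summit.QuantumFields.BalabanUV.T4Continuum.NE7TangentTransportGaugedTopDocked

open Literature.MathematicalPhysics.QuantumFieldTheory.Balaban1983to89
open B7Prop1Explicit B7Prop2Explicit MatrixLog UnitaryModel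
open T4AveragingDeficitWall (IsUnitaryCfg IsSkewDir SmallField Ad dirL1 vary)
open T4AveragingDeficitWallBoundary (IsPeriodicCfg periodBox)
open AveragingDeficitPeriodicCounting (IsPeriodicDir)
open AveragingDeficitTwoLevelPrep (prop1Radius twoLevelSmall)
open AveragingDeficitMultiLevelPrep (cavgIter LevelSmall)
open AveragingDeficitPlaqDeriv (vary_isUnitaryCfg)
open AveragingDeficitDerivCore (dirL1_nonneg)
open MinimalActionLevels (perWin)
open BlockAverageVaryHolo (nbRad)
open NE3TangentCovariantTower (dirIter QbarIter framePotW)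
open NE3HessForm (dAction)
open NE3EnergyShapes (IsUnitarySite IsPeriodicSite)
open NE3QbarIterCovLiftPrep (cruxC)
open NE3RightInverseSolveLetters (thetaLoc)
open NE3HatInvCurlLetters (curl1C curl1C_nonneg)
open NE3EnergyVary (smallField_vary)
open NE3QuadRemainderTower (vary_add_period)
open NE3QbarIterMajorant (wlin)
open NE3CpushGaugeCovariance (cavgIter_gaugeAct)
open NE7MajorantL1 (prod_step_le)
open NE7QbarCurvedBaseTower (sum_norm_QbarIter_le_prod)
open NE7QbarCurvedBaseBudget (sum_norm_QbarIter_sub_QbarIter_le_budget)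
open NE7TangentTransportGaugedTop (tangent_transport_gaugedTop_rightInvW)

noncomputable section

variable {d : ℕ} {n : Type*} [Fintype n] [DecidableEq n]

/-! ## §1 Two small letters: the coarse gauge is `N`-periodic; the single-background `ℓ¹` letter in closed form -/

/-- The restriction `w ↦ u(M•w)` (`M = L^{k+1}`) of an `(N·L^{k+1})`-periodic site gauge to the top corners is `N`-periodic. [folklore] -/
theorem isPeriodic_corner_gauge {𝔸 : Type*} (L N k : ℕ) {u : Site d → 𝔸}
    (huP : ∀ (y : Site d) (i : Fin d), u (y + ((N * L ^ (k + 1) : ℕ) : ℤ) • e i) = u y) (w : Site d) (i : Fin d) :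
    u (((L : ℤ) ^ (k + 1)) • (w + (N : ℤ) • e i)) = u (((L : ℤ) ^ (k + 1)) • w) := by
  have e1 : ((L : ℤ) ^ (k + 1)) • (w + (N : ℤ) • e i) = ((L : ℤ) ^ (k + 1)) • w + ((N * L ^ (k + 1) : ℕ) : ℤ) • e i := by
    rw [smul_add, smul_smul]
    congr 2
    push_cast; ring
  rw [e1, huP]

/-- **THE SINGLE-BACKGROUND `ℓ¹` LETTER OF THE STRAIGHT TOWER IN CLOSED FORM**: for `W` unitary of the multi-level class at radius `x` (`L ≥ 2`) and an
`(N·L^{k+1})`-periodic `Y`, `Σ_{z ∈ periodBox N} Σ_κ ‖QbarIter L (k+1) W Y z κ‖ ≤ K_maj·(L∕L^d)^{k+1}·dirL1 Y (periodBox (N·L^{k+1}))` (F68 §1 ∘ `prod_step_le`). [folklore] -/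
theorem sum_norm_QbarIter_le_Kmaj [Nonempty n] {L : ℕ} (hL : 2 ≤ L) (k : ℕ) {N : ℕ} [NeZero N]
    {W : Site d → Fin d → (Matrix n n ℂ)ˣ} {x : ℝ} (hWu : IsUnitaryCfg W) (hx : 0 ≤ x) (hs : LevelSmall d L k x) (hWx : SmallField W x)
    {Y : Site d → Fin d → Matrix n n ℂ} (hYP : IsPeriodicDir Y ((N * L ^ (k + 1) : ℕ) : ℤ)) :
    ∑ z ∈ periodBox (d := d) N, ∑ κ : Fin d, ‖QbarIter L (k + 1) W Y z κ‖
      ≤ (Real.exp (((L : ℝ) ^ d / L) * ((d : ℝ) * (16 * ((d : ℝ) + 1) * ((d : ℝ) + 4) * (L : ℝ) ^ 2)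
            * (1250 * ((nbRad d L : ℝ) + L) + 8 * ((d : ℝ) * L) + 2 * L)) * (2 / twoLevelSmall d L))
          * ((L : ℝ) / (L : ℝ) ^ d) ^ (k + 1))
        * dirL1 Y (periodBox (d := d) (N * L ^ (k + 1))) := by
  have hL1 : 1 ≤ L := by omega
  have h1 := sum_norm_QbarIter_le_prod (P := N) hL1 k hWu hx hs hWx hYP
  have h2 := prod_step_le (d := d) hL k hx hs
  exact h1.trans (mul_le_mul_of_nonneg_right h2 (dirL1_nonneg _ _))

/-! ## §2 THE (L4) LETTER FOR AN ARBITRARY REPRESENTATIVE OVER THE SAME DATUM -/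

/-- **THE (L4) LETTER OF THE CURVED (APE) FOR AN ARBITRARY REPRESENTATIVE OF A FIELD OVER `W`'s DATUM, DISCHARGED** (statement in the module docstring). [folklore] -/
theorem hTT_gaugedTop [Nonempty n] {L : ℕ} (hL : 2 ≤ L) (k : ℕ) {N : ℕ} [NeZero N]
    {W : Site d → Fin d → (Matrix n n ℂ)ˣ} {x α₀ : ℝ} (hWu : IsUnitaryCfg W) (hWP : IsPeriodicCfg W ((N * L ^ (k + 1) : ℕ) : ℤ))
    (hx : 0 ≤ x) (hα0 : 0 ≤ α₀) (hWx : SmallField W x)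
    (hs' : LevelSmall d L k (x + 4 * (Real.exp α₀ - 1)))
    (hθ : cruxC d L * (((L : ℝ) ^ (k + 1)) ^ 2 * (x + 4 * (Real.exp α₀ - 1))) < 1)
    (hθl : thetaLoc d L * (((L : ℝ) ^ (k + 1)) ^ 2 * (x + 4 * (Real.exp α₀ - 1))) < 1)
    (hε : ((L : ℝ) ^ (k + 1)) ^ 2 * (x + 4 * (Real.exp α₀ - 1)) ≤ 1)
    -- the field over `W`'s datum, of the class
    {U₀ : Site d → Fin d → (Matrix n n ℂ)ˣ} (hU₀u : IsUnitaryCfg U₀) {xU : ℝ} (hxU : 0 ≤ xU) (hsU : LevelSmall d L k xU) (hU₀x : SmallField U₀ xU)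
    (hTop : cavgIter L (k + 1) U₀ = cavgIter L (k + 1) W)
    -- its representative `U₀^u = W e^{Z}`, the gauge NOT pinned: `‖u − 1‖ ≤ θ`
    {u : Site d → (Matrix n n ℂ)ˣ} (huU : IsUnitarySite u) (huP : IsPeriodicSite u ((N * L ^ (k + 1) : ℕ) : ℤ))
    {θ : ℝ} (hθ0 : 0 ≤ θ) (huθ : ∀ y : Site d, ‖((u y : (Matrix n n ℂ)ˣ) : Matrix n n ℂ) - 1‖ ≤ θ)
    {Z : Site d → Fin d → Matrix n n ℂ} (hZs : IsSkewDir Z) (hZP : IsPeriodicDir Z ((N * L ^ (k + 1) : ℕ) : ℤ)) (hZα : ∀ y μ, ‖Z y μ‖ ≤ α₀)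
    (hrep : gaugeAct u U₀ = vary W Z 1) :
    ∀ Y : Site d → Fin d → Matrix n n ℂ, IsSkewDir Y → IsPeriodicDir Y ((N * L ^ (k + 1) : ℕ) : ℤ) → dirIter L (k + 1) W Y = 0 →
      ∃ Y' : Site d → Fin d → Matrix n n ℂ, IsSkewDir Y' ∧ IsPeriodicDir Y' ((N * L ^ (k + 1) : ℕ) : ℤ) ∧ dirIter L (k + 1) (vary W Z 1) Y' = 0 ∧
        |dAction (vary W Z 1) (fun y μ => Y' y μ - Y y μ) (perWin d (N * L ^ (k + 1)))|
          ≤ ((x + 4 * (Real.exp α₀ - 1))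
              * ((curl1C d L / (1 - thetaLoc d L * (((L : ℝ) ^ (k + 1)) ^ 2 * (x + 4 * (Real.exp α₀ - 1)))))
                  * (((L : ℝ) ^ (k + 1)) ^ d / ((L : ℝ) ^ (k + 1)) ^ 2))
              * ((Real.exp (((L : ℝ) ^ d / L) * ((d : ℝ) * (16 * ((d : ℝ) + 1) * ((d : ℝ) + 4) * (L : ℝ) ^ 2)
                      * (1250 * ((nbRad d L : ℝ) + L) + 8 * ((d : ℝ) * L) + 2 * L)) * (2 / twoLevelSmall d L))
                    * ((L : ℝ) / (L : ℝ) ^ d) ^ k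
                    * (((d : ℝ) * (2 * nbRad d L + 1) ^ d) * ((2 * (d : ℝ) + 4) * (L : ℝ) ^ 2) * (2 * (L : ℝ) ^ k) * (Real.exp α₀ - 1)
                      + (17 / 8 * ((L : ℝ) ^ 2) ^ k * (x + 4 * (Real.exp α₀ - 1)))
                        * (((d : ℝ) * (2 * nbRad d L + 1) ^ d) * ((2 * (d : ℝ) + 4)
                              * (2 * (2 * L * (nbRad d L : ℝ) + 128 * ((d : ℝ) + 1) * ((d : ℝ) + 4) * (L : ℝ) ^ 2)))
                          + ((d : ℝ) * (2 * nbRad d L + 1) ^ d) * ((2 * (d : ℝ) + 4) * (L : ℝ) ^ 2 * (2 * (nbRad d L : ℝ))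
                              + 2 * (8 * (L : ℝ) + (1250 * ((nbRad d L : ℝ) + L) + 8 * (d * L) + 2 * L))
                                  * (16 * ((d : ℝ) + 1) * ((d : ℝ) + 4) * (L : ℝ) ^ 2)))))
                + 2 * θ * (Real.exp (((L : ℝ) ^ d / L) * ((d : ℝ) * (16 * ((d : ℝ) + 1) * ((d : ℝ) + 4) * (L : ℝ) ^ 2)
                      * (1250 * ((nbRad d L : ℝ) + L) + 8 * ((d : ℝ) * L) + 2 * L)) * (2 / twoLevelSmall d L))
                    * ((L : ℝ) / (L : ℝ) ^ d) ^ (k + 1))))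
            * dirL1 Y (periodBox (d := d) (N * L ^ (k + 1))) := by
  intro Y hY hYP hYT
  have hL1 : 1 ≤ L := by omega
  set x' : ℝ := x + 4 * (Real.exp α₀ - 1) with hx'
  have he0 : 0 ≤ Real.exp α₀ - 1 := by have := Real.add_one_le_exp α₀; linarith
  have hx'0 : 0 ≤ x' := by rw [hx']; positivity
  have hxx' : x ≤ x' := by rw [hx']; linarith
  -- the representative `U = W e^{Z}`: unitary, periodic, in the class at the common radius `x′`
  set U : Site d → Fin d → (Matrix n n ℂ)ˣ := vary W Z 1 with hU
  have hUu : IsUnitaryCfg U := vary_isUnitaryCfg hWu hZs 1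
  have hUP : IsPeriodicCfg U ((N * L ^ (k + 1) : ℕ) : ℤ) := vary_add_period hWP hZP 1
  have hUx' : SmallField U x' := by rw [hU, hx']; exact smallField_vary hWu hWx hZs hZα
  have hWx' : SmallField W x' := fun y κ κ' hne => (hWx y κ κ' hne).trans hxx'
  -- the relative link radius of the pair: `‖W⁻¹U − 1‖ = ‖e^{Z} − 1‖ ≤ e^{α₀} − 1`
  have hr₀ : ∀ (y : Site d) (μ : Fin d), ‖(((W y μ)⁻¹ * U y μ : (Matrix n n ℂ)ˣ) : Matrix n n ℂ) - 1‖ ≤ Real.exp α₀ - 1 := by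
    intro y μ
    have e1 : (W y μ)⁻¹ * U y μ = expUnit (((1 : ℝ) : ℂ) • Z y μ) := by rw [hU]; unfold vary; rw [inv_mul_cancel_left]
    rw [e1, val_expUnit]
    refine B7Transfer.norm_exp_sub_one_le_of_le _ ?_
    rw [Complex.ofReal_one, one_smul]; exact hZα y μ
  -- the top of the representative is the gauge transform of the top of `W` by the corner values of `u`
  set c := (fun w : Site d => u (((L : ℤ) ^ (k + 1)) • w)) with hc_def
  have hc : ∀ w, c w ∈ unitaryUnits (Matrix n n ℂ) := fun w => huU _
  have hcP : ∀ (w : Site d) (i : Fin d), c (w + (N : ℤ) • e i) = c w := fun w i => isPeriodic_corner_gauge L N k huP w i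
  have hcθ : ∀ w : Site d, ‖((c w : (Matrix n n ℂ)ˣ) : Matrix n n ℂ) - 1‖ ≤ θ := fun w => huθ _
  have hTopc : cavgIter L (k + 1) U = gaugeAct c (cavgIter L (k + 1) W) := by
    rw [hc_def, ← hrep, cavgIter_gaugeAct hL1 k hU₀u hxU hsU hU₀x huU, hTop]
  -- the letters: `Λ` by F73, `Λ_W` by §1
  have hΛ := fun (Y₂ : Site d → Fin d → Matrix n n ℂ) (_ : IsSkewDir Y₂) (hY₂P : IsPeriodicDir Y₂ ((N * L ^ (k + 1) : ℕ) : ℤ))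
      (_ : dirIter L (k + 1) W Y₂ = 0) =>
    sum_norm_QbarIter_sub_QbarIter_le_budget (d := d) hL k hUu hWu hx'0 hs' hUx' hWx' hUP hWP he0 hr₀ hY₂P
  have hΛW := fun (Y₂ : Site d → Fin d → Matrix n n ℂ) (_ : IsSkewDir Y₂) (hY₂P : IsPeriodicDir Y₂ ((N * L ^ (k + 1) : ℕ) : ℤ))
      (_ : dirIter L (k + 1) W Y₂ = 0) =>
    sum_norm_QbarIter_le_Kmaj (d := d) hL k hWu hx'0 hs' hWx' hY₂P
  -- F84
  exact tangent_transport_gaugedTop_rightInvW hL k hUu hWu hUP hWP hx'0 hs' hUx' hWx' hθ hθl hε hx'0 hUx' hc hcP hTopc hθ0 hcθ hΛW hΛ Y hY hYP hYT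

end

end Summit.QuantumFields.BalabanUV.T4Continuum.NE7TangentTransportGaugedTopDocked
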